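import Summits.QuantumFields.YangMills.Theorems.BalabanUVNodesN07SplitClauseOfTildeTower
import Summits.QuantumFields.YangMills.Theorems.BalabanUVNodesN07TildeTowerLettersFromFine
import HarnessLib

/-!
# N07 [B11] (= [15] = [Balaban1985Variational]) Sect. F, road of record R0′, WIDTH-209 row (r2), FILE 17: **THE SHEAR LETTER IS AFFINE AND UNIFORM IN THE HEIGHT** —
# with the data lane's per-level plaquette letters `a_i = 2α₀(Lⁱη_k)²` ([B7] Prop 2 on the `□̃`-tower, dag-n07-w6 g2 p640582) and the radial within-block letters, FILE 16's explicit
# `ς_□̃` is `≤ 2d(M + 4ρ + 1)·(4κ·α₀ + v_k + 2t)` with `κ = κ(d, L)` — no `k`, no `Lᵏ` — and FILE 16's door reads on that letter; with p640582 the plaquette letters come from ONE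
# fine-regularity hypothesis near `□̃`

Cell `pub-ymgap`, width seat `pub-ymgap-dag-n07-w8` g6, WIDTH-209 N07 row (r2) of road R0′, CLAIM-17 ∕ INTENT-17 (cell bus; own lineage FILE 16 → FILE 17; dag-n07-w6 g2's
`N07TildeTowerLettersFromFine` CONSUMED BY NAME on their word).  `--kind proof --supports stmt-QuantumFields-27364 --as helper` (K1⁹ per dag-lead KEY MAP v2); count-neutral; def-free.
[15] = [Balaban1985Variational] (144)–(145) pp. 300–301, (150)–(152) p. 301, (157)–(159) pp. 302–303, (164)–(165) p. 304, (168) p. 304; [6] = [Balaban1985RegularSpaces] p. 98, Lemma 1 (1.25) p. 79;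
[B7] = [Balaban1985Averaging] Prop. 2 p. 22, (8) p. 19; [4] = [Balaban1984PropagatorsII] (2.1)–(2.4) p. 224, Cor. 2.8 p. 249.

THE POINT (the positive face of LOCATED-CRUDE-SHEAR-LETTER, cell bus I.36833).  The σ-doors asked `d(M′+4ρ+3)L^{(K−n)−j}(v_j + a_j) ≤ σ ≤ ½` at every level — a smallness in the HEIGHT.
FILE 16's ς-door asks instead `ς_□̃ ≤ ½` for the explicit `ς_□̃ = 2d·(D·θ₀ + Σ_{i<k}(D ∕ L^{i+1} + 1)·θ_{i+1} + D·2η_k t)`, `D = Lᵏ(M+4ρ)`, `θ_i = κ·a_i` (`i < k`), `θ_k = v_k`.  With print's letters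
`a_i = 2α₀(Lⁱη_k)²` ([15] (145)∕(7) via [B7] Prop 2 — dag-n07-w6 g2 `plaqSmallOn_tildeTowerWide_of_fine`) every term is geometric: `D·a₀ = 2α₀(M+4ρ)·L^{−k}`, `(D ∕ L^{m} + 1)·a_m ≤ 2α₀(M+4ρ+1)·L^{m−k}`
(`1 ≤ m < k`), `(D ∕ Lᵏ + 1)·v_k = (M+4ρ+1)·v_k`, `D·2η_k t = 2(M+4ρ)t`, and `Σ_{m=1}^{k−1} L^{m−k} ≤ 1` for `L ≥ 2`.  Hence (§1) `ς_□̃ ≤ 2d(M+4ρ+1)·(4κα₀ + v_k + 2t)`,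
`κ := c_τ + 7((d+2)L)²∕4 + (d+1)(L−1)·c_τ`, `c_τ := (d(L−1)+1)(d−1)(L−1)` — AFFINE in `(α₀, v_k, t)`, UNIFORM in `k` (the S6 head's «affine letters» shape, dag-n07-w4 p638406 `budget_affine`).
(§2) FILE 16's radial door with `a_i := 2α₀(Lⁱη_k)²`, smallness and threshold READ ON THE AFFINE LETTER (weakening through `0 ≤ C`, `0 < B₃`).  (§3) ∘ dag-n07-w6 g2 p640582: the per-level
plaquette letters on the `□̃`-tower DISCHARGED from ONE fine-regularity hypothesis `PlaqSmallOn {q | q.src ∈ □̃_wide} (α₀η_k²) U` on the field `U` itself (plaquettes are invariant under both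
gauges, `dist1_plaqHol_iter_gaugeAct`), `0 < α₀`, `143((d+4)²∕4)²α₀ ≤ ⅓`, `2α₀ ≤ 2δ_N∕((d+4)L)²`.

WHAT IS PROVED (sorry-free; no definition; axioms standard).
* §1 `geomTail_le_one` (`Σ_{j<n} x^{j+1} ≤ 1` for `0 ≤ x ≤ ½`) · `pow_mul_div_pow` (`Lᵏ·W ∕ L^{m} = L^{k−m}·W` in `ℕ`, `m ≤ k`) · `pow_mul_inv_pow` (`Lᵐ·(L⁻¹)ᵏ = (L⁻¹)^{k−m}`) ·
  ★★ `shearLetter_radial_le_affine` (the bound above, any `P : Params`, `1 ≤ k`, `0 ≤ α₀, v_k, t`).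
* §2 ★★★ `localGaugeSplitOn_of_gauge152_recordShearRadialTildeTower_affine_cubeDomains_box F N` (FILE 16's radial door at `a_i := 2α₀(Lⁱη_{K−n})²`, read on the affine letter).
* §3 ★★★★ `localGaugeSplitOn_of_gauge152_recordShearTildeTower_of_fine_cubeDomains_box F N` (§2 with `hplaq`∕`hplaqB`∕`ht` DISCHARGED from fine regularity near `□̃` — dag-n07-w6 g2 p640582 §1–§3 BY NAME).
HONEST SCOPE.  Count-neutral real arithmetic + by-name composition of LANDED theorems (this base FILE 16; dag-n07-w6 g2 `N07TildeTowerLettersFromFine`); `α₀`, `v_k`, S3's `(u, A, t)` on □′ and on □̃,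
the radial WLOG of the representative's averages, the placement of `□̃_wide` inside the (17)-region (dag-n07-w6 g2's OFFER FILE 3) and the affine smallness are HYPOTHESES ∕ the consumer's; nothing of
[15]∕[6]∕[B7]∕[4] ANALYSIS asserted beyond the landed ports; joint satisfiability with the head's budget NOT claimed; HCHART ∕ `LocalLettersSplitTopStepCore(G∕R)` ∕ `DatumGaugeSplitTopStepCore(G∕R)` ∕
`HalvingStepTop(Core)` ∕ `stub_prop8StepCoP13` NOT discharged; K0⁷ ∕ K1⁹ NOT closed; N07 NOT discharged; counts unmoved (typed 28∕28 · discharged 5∕27); one finite 𝕋⁴ programme at fixed ε — the route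
closes the conditional finite-𝕋⁴ rung `BalabanLadder.UV` ONLY; the YM mass gap (Clay) is NOT proved by any of this; nothing continuum ∕ ℝ⁴ ∕ OS.  No `sorry`, no `def`, no `instance`, no `notation`.

RELATED IN THE TREE, NOT DUPLICATED (stem check 2026-08-28T14:26Z: `ls …/Theorems | rg -i 'ShearLetterAffine|LetterAffine|AffineShear'` = ∅): FILE 16 (the door — CONSUMED), dag-n07-w6 g2
`N07TildeTowerLettersFromFine` (the letters from fine regularity + its `v`-clause edition `…_of_fine`, a different output — CONSUMED), dag-n07-w4 `N07SplitClauseHeadBudgetAffine` (the budget FOR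
affine letters — the consumer's side, not restated), `N07DataDownTheTowerLevelBoxes.ladder_of_sum` (the `v`-ladder's affine evaluation — a different sum).
-/

set_option autoImplicit false

noncomputable section
open scoped BigOperators Matrix.Norms.L2Operator

namespace Summit.QuantumFields.YangMills.BalabanUVNodes.N07ShearLetterAffine

open Literature.MathematicalPhysics.QuantumFieldTheory.Balaban1983to89
open Literature.MathematicalPhysics.QuantumFieldTheory.Balaban1983to89.Node00
open Literature.MathematicalPhysics.QuantumFieldTheory.Balaban1983to89.B12RegularSpaces111 (gaugeU expI grad)
open B15Eq112TorusCover (cover)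
open B14DomainGeom (Pt)
open B8Eq131Cubes (gs sqLo sqHi tLo tHi box cube)
open B8Ineq130 (tlo thi)
open B6SectAOperatorsV1 (BondIdx)
open T4Continuum (T4Family)
open T4AxialGaugeSmallField (castSite)
open B16Sect1Backgrounds (toMS)
open GaugeField (gaugeAct)
open MatrixLog (mlog)
open ExpMeanLog (deltaSU deltaSU_pos)
open Summit.QuantumFields.Balaban3D.Carriers (radialContourData)
open Summit.QuantumFields.YangMills.Theorems.K0FlatCubeOpsTextP (flatH)
open Summit.QuantumFields.YangMills.BalabanUVNodes.N07HalvingStepTopOfLocalLetters (Letters10On)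
open Summit.QuantumFields.YangMills.BalabanUVNodes.N07LocalLettersSplitCore (LocalGaugeSplitOn)
open Summit.QuantumFields.YangMills.BalabanUVNodes.N07SplitClauseOfTildeTower (localGaugeSplitOn_of_gauge152_recordShearRadialTildeTower_cubeDomains_box)
open Summit.QuantumFields.YangMills.BalabanUVNodes.N07DataDownTheTowerBlowDown (dist1_plaqHol_iter_gaugeAct)
open Summit.QuantumFields.YangMills.BalabanUVNodes.N07TildeTowerLettersFromFine (plaqSmallOn_tildeTowerWide_of_fine smallness_ht_of_alpha
  exists_label_near_of_block_position mem_tildeTowerWide_of_blockOf_mem boxPlaqs_tilde_subset_tildeTowerWide)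

/-! ## §1  Arithmetic: the explicit shear letter is affine and uniform in the height -/

section Arithmetic

/-- `Σ_{j<n} x^{j+1} ≤ 1` for `0 ≤ x ≤ ½` (induction: `Σ_{j<n+1} x^{j+1} = x + x·Σ_{j<n} x^{j+1} ≤ 2x ≤ 1`). [folklore] -/
theorem geomTail_le_one {x : ℝ} (hx0 : 0 ≤ x) (hx : x ≤ 1 / 2) : ∀ n : ℕ, ∑ j ∈ Finset.range n, x ^ (j + 1) ≤ 1 := by
  intro n
  induction n with
  | zero => simp
  | succ n ih =>
    rw [Finset.sum_range_succ', zero_add, pow_one]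
    have h1 : ∑ j ∈ Finset.range n, x ^ (j + 1 + 1) = x * ∑ j ∈ Finset.range n, x ^ (j + 1) := by
      rw [Finset.mul_sum]
      exact Finset.sum_congr rfl fun j _ => by ring
    rw [h1]
    nlinarith [ih, Finset.sum_nonneg (fun j (_ : j ∈ Finset.range n) => pow_nonneg hx0 (j + 1))]

/-- `Lᵏ·W ∕ Lᵐ = L^{k−m}·W` in `ℕ` for `m ≤ k`, `0 < L`. [folklore] -/
theorem pow_mul_div_pow {L : ℕ} (hL : 0 < L) (W : ℕ) {k m : ℕ} (hm : m ≤ k) : L ^ k * W / L ^ m = L ^ (k - m) * W := by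
  have hk : k = m + (k - m) := by omega
  rw [hk, pow_add, Nat.add_sub_cancel_left, mul_assoc, Nat.mul_div_cancel_left _ (pow_pos hL m)]

/-- `Lᵐ·(L⁻¹)ᵏ = (L⁻¹)^{k−m}` for `m ≤ k`, `L ≠ 0` (as reals). [folklore] -/
theorem pow_mul_inv_pow {L : ℝ} (hL : L ≠ 0) {k m : ℕ} (hm : m ≤ k) : L ^ m * L⁻¹ ^ k = L⁻¹ ^ (k - m) := by
  have hk : k = m + (k - m) := by omega
  conv_lhs => rw [hk, pow_add]
  rw [← mul_assoc, ← mul_pow, mul_inv_cancel₀ hL, one_pow, one_mul]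

/-- ★★ **THE SHEAR LETTER IS AFFINE AND UNIFORM IN THE HEIGHT**: FILE 16's explicit radial `ς_□̃` at the per-level plaquette letters `a_i := 2α₀(Lⁱη_k)²` obeys
`ς_□̃ ≤ 2d(M + 4ρ + 1)·(4κ·α₀ + v_k + 2t)`, `κ := c_τ + 7((d+2)L)²∕4 + (d+1)(L−1)·c_τ`, `c_τ := (d(L−1)+1)(d−1)(L−1)` — for every `P : Params` (`L ≥ 2`), `1 ≤ k`, `0 ≤ α₀, v_k, t`.
[cite: Balaban1985Variational, (145) p.301, (151)–(152) p.301; Balaban1985Averaging, Prop. 2 p.22] -/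
theorem shearLetter_radial_le_affine (P : Params) {k : ℕ} (hk1 : 1 ≤ k) (M ρ : ℕ) {α₀ vk t : ℝ} (hα : 0 ≤ α₀) (ht : 0 ≤ t) :
    2 * (P.d * (((P.L ^ (k) * (M + 4 * ρ) : ℕ) : ℝ) * ((((P.d * (P.L - 1) + 1 : ℕ) : ℝ) * ((((P.d - 1 : ℕ) : ℝ) * ((P.L - 1 : ℕ) : ℝ)) * (2 * α₀ * (((P.L : ℝ) ^ 0 * P.eta k) ^ 2)))) + (7 * (((((P.d + 2) * P.L : ℕ) : ℝ) ^ 2 / 4) * (2 * α₀ * (((P.L : ℝ) ^ 0 * P.eta k) ^ 2))) +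
            (((P.d + 1) * (P.L - 1) : ℕ) : ℝ) * (((P.d * (P.L - 1) + 1 : ℕ) : ℝ) * ((((P.d - 1 : ℕ) : ℝ) * ((P.L - 1 : ℕ) : ℝ)) * (2 * α₀ * (((P.L : ℝ) ^ 0 * P.eta k) ^ 2)))))) +
          ∑ i ∈ Finset.range (k), (((P.L ^ (k) * (M + 4 * ρ) / P.L ^ (i + 1) + 1 : ℕ)) : ℝ) *
            (if i + 1 < k then (((P.d * (P.L - 1) + 1 : ℕ) : ℝ) * ((((P.d - 1 : ℕ) : ℝ) * ((P.L - 1 : ℕ) : ℝ)) * (2 * α₀ * (((P.L : ℝ) ^ (i + 1) * P.eta k) ^ 2)))) + (7 * (((((P.d + 2) * P.L : ℕ) : ℝ) ^ 2 / 4) * (2 * α₀ * (((P.L : ℝ) ^ (i + 1) * P.eta k) ^ 2))) + (((P.d + 1) * (P.L - 1) : ℕ) : ℝ) * (((P.d * (P.L - 1) + 1 : ℕ) : ℝ) * ((((P.d - 1 : ℕ) : ℝ) * ((P.L - 1 : ℕ) : ℝ)) * (2 * α₀ * (((P.L : ℝ) ^ (i + 1) * P.eta k) ^ 2)))))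
              else vk) + ((P.L ^ (k) * (M + 4 * ρ) : ℕ) : ℝ) * (2 * (P.eta (k) * t)))) ≤
      2 * ((P.d : ℝ) * (((M + 4 * ρ + 1 : ℕ) : ℝ) * (4 * (((P.d * (P.L - 1) + 1 : ℕ) : ℝ) * (((P.d - 1 : ℕ) : ℝ) * ((P.L - 1 : ℕ) : ℝ)) + 7 * ((((P.d + 2) * P.L : ℕ) : ℝ) ^ 2 / 4) + (((P.d + 1) * (P.L - 1) : ℕ) : ℝ) * (((P.d * (P.L - 1) + 1 : ℕ) : ℝ) * (((P.d - 1 : ℕ) : ℝ) * ((P.L - 1 : ℕ) : ℝ)))) * α₀ + vk + 2 * t))) := by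
  -- letters of the arithmetic
  have hL2 : (2 : ℝ) ≤ (P.L : ℝ) := by exact_mod_cast (show 2 ≤ P.L by have := P.hL.2; omega)
  have hL0 : (P.L : ℝ) ≠ 0 := by positivity
  have hLpos : 0 < P.L := P.L_pos
  set x : ℝ := (P.L : ℝ)⁻¹ with hxdef
  have hx0 : 0 ≤ x := by positivity
  have hx2 : x ≤ 1 / 2 := by
    rw [hxdef, inv_eq_one_div]
    exact one_div_le_one_div_of_le (by norm_num) hL2
  have hx1 : x ≤ 1 := hx2.trans (by norm_num)
  have hη : P.eta k = x ^ k := rfl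
  set A : ℝ := ((P.d * (P.L - 1) + 1 : ℕ) : ℝ) with hA
  set B : ℝ := (((P.d - 1 : ℕ) : ℝ) * ((P.L - 1 : ℕ) : ℝ)) with hB
  set C7 : ℝ := ((((P.d + 2) * P.L : ℕ) : ℝ) ^ 2 / 4) with hC7
  set C1 : ℝ := (((P.d + 1) * (P.L - 1) : ℕ) : ℝ) with hC1
  set W : ℝ := ((M + 4 * ρ : ℕ) : ℝ) with hW
  have hA0 : 0 ≤ A := by positivity
  have hB0 : 0 ≤ B := by positivity
  have hC70 : 0 ≤ C7 := by positivity
  have hC10 : 0 ≤ C1 := by positivity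
  have hW0 : 0 ≤ W := by positivity
  have hκ0 : 0 ≤ A * B + 7 * C7 + C1 * (A * B) := by positivity
  have hW1 : ((M + 4 * ρ + 1 : ℕ) : ℝ) = W + 1 := by rw [hW]; push_cast; ring
  -- the letter `θ(a) = κ·a`
  have hθ : ∀ a : ℝ, A * (B * a) + (7 * (C7 * a) + C1 * (A * (B * a))) = (A * B + 7 * C7 + C1 * (A * B)) * a := fun a => by ring
  -- `D = Lᵏ·W` and `D·ηᵏ = W`
  have hD : ((P.L ^ k * (M + 4 * ρ) : ℕ) : ℝ) = (P.L : ℝ) ^ k * W := by rw [hW]; push_cast; ring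
  have hLx : ∀ p : ℕ, (P.L : ℝ) ^ p * x ^ p = 1 := fun p => by
    rw [← mul_pow, hxdef, mul_inv_cancel₀ hL0, one_pow]
  have hDη : ((P.L ^ k * (M + 4 * ρ) : ℕ) : ℝ) * x ^ k = W := by
    rw [hD, mul_right_comm, hLx, one_mul]
  -- (1) the level-0 term: `D·θ(a₀) = κ·2α₀·W·xᵏ ≤ 2κα₀·W`
  have hxk1 : x ^ k ≤ 1 := pow_le_one₀ hx0 hx1
  have hT0 : ((P.L ^ k * (M + 4 * ρ) : ℕ) : ℝ) * (A * (B * (2 * α₀ * (((P.L : ℝ) ^ 0 * P.eta k) ^ 2))) +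
        (7 * (C7 * (2 * α₀ * (((P.L : ℝ) ^ 0 * P.eta k) ^ 2))) + C1 * (A * (B * (2 * α₀ * (((P.L : ℝ) ^ 0 * P.eta k) ^ 2)))))) ≤
      2 * (A * B + 7 * C7 + C1 * (A * B)) * α₀ * W := by
    rw [hθ, hη, pow_zero, one_mul]
    have e : ((P.L ^ k * (M + 4 * ρ) : ℕ) : ℝ) * ((A * B + 7 * C7 + C1 * (A * B)) * (2 * α₀ * (x ^ k) ^ 2)) =
        2 * (A * B + 7 * C7 + C1 * (A * B)) * α₀ * W * x ^ k := by
      rw [← hDη]; ring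
    rw [e]
    have h0 : 0 ≤ 2 * (A * B + 7 * C7 + C1 * (A * B)) * α₀ * W := by positivity
    calc 2 * (A * B + 7 * C7 + C1 * (A * B)) * α₀ * W * x ^ (k)
        ≤ 2 * (A * B + 7 * C7 + C1 * (A * B)) * α₀ * W * 1 := mul_le_mul_of_nonneg_left hxk1 h0
      _ = 2 * (A * B + 7 * C7 + C1 * (A * B)) * α₀ * W := mul_one _
  -- (2) the Landau term: `D·2ηt = 2Wt`
  have hTt : ((P.L ^ k * (M + 4 * ρ) : ℕ) : ℝ) * (2 * (P.eta k * t)) = 2 * W * t := by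
    rw [hη]
    have e : ((P.L ^ k * (M + 4 * ρ) : ℕ) : ℝ) * (2 * (x ^ k * t)) = 2 * (((P.L ^ k * (M + 4 * ρ) : ℕ) : ℝ) * x ^ k) * t := by ring
    rw [e, hDη]
  -- (3) the sum: split off the top term (`i = k − 1`)
  obtain ⟨k', rfl⟩ : ∃ k', k = k' + 1 := ⟨k - 1, by omega⟩
  have hS : ∑ i ∈ Finset.range (k' + 1), (((P.L ^ (k' + 1) * (M + 4 * ρ) / P.L ^ (i + 1) + 1 : ℕ)) : ℝ) *
        (if i + 1 < k' + 1 then A * (B * (2 * α₀ * (((P.L : ℝ) ^ (i + 1) * P.eta (k' + 1)) ^ 2))) +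
          (7 * (C7 * (2 * α₀ * (((P.L : ℝ) ^ (i + 1) * P.eta (k' + 1)) ^ 2))) + C1 * (A * (B * (2 * α₀ * (((P.L : ℝ) ^ (i + 1) * P.eta (k' + 1)) ^ 2)))))
          else vk) ≤
      2 * (A * B + 7 * C7 + C1 * (A * B)) * α₀ * (W + 1) + (W + 1) * vk := by
    rw [Finset.sum_range_succ, if_neg (lt_irrefl _)]
    -- the top coefficient is `W + 1`
    have htopc : (((P.L ^ (k' + 1) * (M + 4 * ρ) / P.L ^ (k' + 1) + 1 : ℕ)) : ℝ) = W + 1 := by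
      rw [pow_mul_div_pow hLpos _ le_rfl, Nat.sub_self, pow_zero, one_mul, hW]; push_cast; ring
    rw [htopc]
    -- the middle terms
    have hmid : ∑ i ∈ Finset.range k', (((P.L ^ (k' + 1) * (M + 4 * ρ) / P.L ^ (i + 1) + 1 : ℕ)) : ℝ) *
        (if i + 1 < k' + 1 then A * (B * (2 * α₀ * (((P.L : ℝ) ^ (i + 1) * P.eta (k' + 1)) ^ 2))) +
          (7 * (C7 * (2 * α₀ * (((P.L : ℝ) ^ (i + 1) * P.eta (k' + 1)) ^ 2))) + C1 * (A * (B * (2 * α₀ * (((P.L : ℝ) ^ (i + 1) * P.eta (k' + 1)) ^ 2)))))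
          else vk) ≤
        ∑ i ∈ Finset.range k', 2 * (A * B + 7 * C7 + C1 * (A * B)) * α₀ * (W + 1) * x ^ (k' - 1 - i + 1) := by
      refine Finset.sum_le_sum fun i hi => ?_
      have hik : i < k' := Finset.mem_range.1 hi
      rw [if_pos (by omega), hθ, hη, pow_mul_div_pow hLpos _ (by omega : i + 1 ≤ k' + 1), pow_mul_inv_pow hL0 (by omega : i + 1 ≤ k' + 1)]
      have hp : k' + 1 - (i + 1) = k' - 1 - i + 1 := by omega
      rw [hp]
      set y : ℝ := x ^ (k' - 1 - i + 1) with hy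
      have hy0 : 0 ≤ y := by positivity
      have hy1 : y ≤ 1 := pow_le_one₀ hx0 hx1
      have hLy : (P.L : ℝ) ^ (k' - 1 - i + 1) * y = 1 := hLx _
      have hcoef : (((P.L ^ (k' - 1 - i + 1) * (M + 4 * ρ) + 1 : ℕ)) : ℝ) = (P.L : ℝ) ^ (k' - 1 - i + 1) * W + 1 := by rw [hW]; push_cast; ring
      rw [hcoef]
      have e : ((P.L : ℝ) ^ (k' - 1 - i + 1) * W + 1) * ((A * B + 7 * C7 + C1 * (A * B)) * (2 * α₀ * y ^ 2)) =
          2 * (A * B + 7 * C7 + C1 * (A * B)) * α₀ * (W * ((P.L : ℝ) ^ (k' - 1 - i + 1) * y) * y + y ^ 2) := by ring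
      rw [e, hLy, mul_one]
      have hy2 : y ^ 2 ≤ y := by
        have h := mul_le_mul_of_nonneg_left hy1 hy0
        rw [mul_one] at h
        calc y ^ 2 = y * y := sq y
          _ ≤ y := h
      have h0 : 0 ≤ 2 * (A * B + 7 * C7 + C1 * (A * B)) * α₀ := by positivity
      have key : W * y + y ^ 2 ≤ (W + 1) * y := by
        have e2 : (W + 1) * y = W * y + y := by ring
        rw [e2]; exact add_le_add le_rfl hy2
      calc 2 * (A * B + 7 * C7 + C1 * (A * B)) * α₀ * (W * y + y ^ 2)
          ≤ 2 * (A * B + 7 * C7 + C1 * (A * B)) * α₀ * ((W + 1) * y) := mul_le_mul_of_nonneg_left key h0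
        _ = 2 * (A * B + 7 * C7 + C1 * (A * B)) * α₀ * (W + 1) * y := by ring
    -- the geometric tail
    have htail : ∑ i ∈ Finset.range k', 2 * (A * B + 7 * C7 + C1 * (A * B)) * α₀ * (W + 1) * x ^ (k' - 1 - i + 1) ≤
        2 * (A * B + 7 * C7 + C1 * (A * B)) * α₀ * (W + 1) := by
      have hrefl : ∑ i ∈ Finset.range k', x ^ (k' - 1 - i + 1) = ∑ j ∈ Finset.range k', x ^ (j + 1) :=
        Finset.sum_range_reflect (fun j => x ^ (j + 1)) k'
      rw [← Finset.mul_sum, hrefl]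
      have hg := geomTail_le_one hx0 hx2 k'
      have h0 : 0 ≤ 2 * (A * B + 7 * C7 + C1 * (A * B)) * α₀ * (W + 1) := by positivity
      calc 2 * (A * B + 7 * C7 + C1 * (A * B)) * α₀ * (W + 1) * ∑ j ∈ Finset.range k', x ^ (j + 1)
          ≤ 2 * (A * B + 7 * C7 + C1 * (A * B)) * α₀ * (W + 1) * 1 := mul_le_mul_of_nonneg_left hg h0
        _ = 2 * (A * B + 7 * C7 + C1 * (A * B)) * α₀ * (W + 1) := mul_one _
    linarith [hmid, htail]
  -- assemble
  rw [hW1]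
  have hd0 : (0 : ℝ) ≤ (P.d : ℝ) := by positivity
  have hinner : ((P.L ^ (k' + 1) * (M + 4 * ρ) : ℕ) : ℝ) * (A * (B * (2 * α₀ * (((P.L : ℝ) ^ 0 * P.eta (k' + 1)) ^ 2))) +
        (7 * (C7 * (2 * α₀ * (((P.L : ℝ) ^ 0 * P.eta (k' + 1)) ^ 2))) + C1 * (A * (B * (2 * α₀ * (((P.L : ℝ) ^ 0 * P.eta (k' + 1)) ^ 2)))))) +
      ∑ i ∈ Finset.range (k' + 1), (((P.L ^ (k' + 1) * (M + 4 * ρ) / P.L ^ (i + 1) + 1 : ℕ)) : ℝ) *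
        (if i + 1 < k' + 1 then A * (B * (2 * α₀ * (((P.L : ℝ) ^ (i + 1) * P.eta (k' + 1)) ^ 2))) +
          (7 * (C7 * (2 * α₀ * (((P.L : ℝ) ^ (i + 1) * P.eta (k' + 1)) ^ 2))) + C1 * (A * (B * (2 * α₀ * (((P.L : ℝ) ^ (i + 1) * P.eta (k' + 1)) ^ 2)))))
          else vk) + ((P.L ^ (k' + 1) * (M + 4 * ρ) : ℕ) : ℝ) * (2 * (P.eta (k' + 1) * t)) ≤
      (W + 1) * (4 * (A * B + 7 * C7 + C1 * (A * B)) * α₀ + vk + 2 * t) := by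
    rw [hTt]
    have h1 : 2 * (A * B + 7 * C7 + C1 * (A * B)) * α₀ * W ≤ 2 * (A * B + 7 * C7 + C1 * (A * B)) * α₀ * (W + 1) :=
      mul_le_mul_of_nonneg_left (by linarith) (by positivity)
    have h2 : 2 * W * t ≤ 2 * (W + 1) * t := mul_le_mul_of_nonneg_right (by linarith) ht
    have e3 : (W + 1) * (4 * (A * B + 7 * C7 + C1 * (A * B)) * α₀ + vk + 2 * t) =
        2 * (A * B + 7 * C7 + C1 * (A * B)) * α₀ * (W + 1) + (2 * (A * B + 7 * C7 + C1 * (A * B)) * α₀ * (W + 1) + (W + 1) * vk) + 2 * (W + 1) * t := by ring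
    rw [e3]
    linarith [hT0, hS, h1, h2]
  exact mul_le_mul_of_nonneg_left (mul_le_mul_of_nonneg_left hinner hd0) (by norm_num)

end Arithmetic

/-! ## §2  FILE 16's radial door read on the affine letter -/

section Door

open scoped Classical in
/-- ★★★ **THE ς-DOOR AT THE HEAD's FAMILY, RADIAL, READ ON THE AFFINE LETTER**: FILE 16's `localGaugeSplitOn_of_gauge152_recordShearRadialTildeTower_cubeDomains_box` at the plaquette letters
`a_i := 2α₀(Lⁱη_{K−n})²` (`0 ≤ α₀`), with the smallness and the threshold stated on `2d(M+4ρ+1)(4κα₀ + v_k + 2t)` (§1; weakening through `0 ≤ C`, `0 < B₃`).  Displayed on the shear side: the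
radial WLOG `hax`, the plaquette hypotheses with these letters and their Lemma-1 smallness, the top letter `v_k`, S3's `t` on `□′` and on `□̃`, `α₀`.
[cite: Balaban1985Variational, (144)–(145) pp.300–301, (150)–(152) p.301, (157)–(159) pp.302–303, (164)–(165) p.304, (168) p.304; Balaban1985RegularSpaces, p.98, Lemma 1 (1.25) p.79; Balaban1984PropagatorsII, (2.1)–(2.4) p.224, Cor. 2.8 (2.150)–(2.151) p.249; Balaban1985Averaging, Prop. 2 p.22, (8) p.19] -/
theorem localGaugeSplitOn_of_gauge152_recordShearRadialTildeTower_affine_cubeDomains_box (F : T4Family) (N : ℕ) [NeZero N] :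
    ∃ (Mh₀ R₀ : ℕ) (C δ₀ δ₁ B₃ : ℝ), 0 ≤ C ∧ 0 < δ₀ ∧ 0 < δ₁ ∧ 0 < B₃ ∧
    ∀ (n K : ℕ) (_ : 1 ≤ K - n) (_ : K - n + 1 ≤ F.m + K) (hk : K - n ≤ (F.P K).m + (F.P K).K)
      {Mh R a' : ℕ} (_ : Mh = F.L ^ a') (_ : Mh₀ ≤ Mh) (_ : R₀ ≤ R) (_ : a' + 3 ≤ F.m + n)
      {a : Pt (F.P K).d} {M ρ : ℕ} (_ : 1 ≤ M)
      (_ : F.L * Mh ∣ ρ) (_ : ∀ i, ((F.L * Mh : ℕ) : ℤ) ∣ a i) (_ : F.L * Mh ∣ M) (_ : F.L * Mh ∣ (F.P K).sitesPerDir (K - n)) (_ : R * (F.L * Mh) ≤ ρ)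
      (_ : F.L ≤ ρ) (_ : Set.InjOn (cover (F.P K)) (cube (F.P K).L a M ρ (K - n) 0))
      {HV : (BondIdx (cubeDomains (F.P K) a M ρ (K - n) hk) → MatA N) →ₗ[ℂ] (PBond (F.P K) 0 → MatA N)}
      (_ : ∀ (B' : BondIdx (cubeDomains (F.P K) a M ρ (K - n) hk) → MatA N) (b : PBond (F.P K) 0),
        HV B' b = ∑ c, ((flatH (F.P K) (K - n) (cubeDomains (F.P K) a M ρ (K - n) hk) (Pi.single c 1) b : ℝ) : ℂ) • B' c)
      -- the CANONICAL level boxes of the tower (four equation binders)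
      {lo hi : ℕ → Pt (F.P K).d}
      (_ : lo 0 = fun i => ((F.P K).L : ℤ) * (sqLo (F.P K).L a ρ (K - n) 1 i - 1))
      (_ : hi 0 = fun i => ((F.P K).L : ℤ) * (sqHi (F.P K).L a M ρ (K - n) 1 i + 1) + (((F.P K).L : ℤ) - 1))
      (_ : ∀ j, 1 ≤ j → lo j = sqLo (F.P K).L a ρ (K - n) j - 1) (_ : ∀ j, 1 ≤ j → hi j = sqHi (F.P K).L a M ρ (K - n) j + 1)
      -- the shear gauge `u♮`; the shift family, DOMINATED by the (r1) letter family, and its datum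
      (uL : GaugeTransf (F.P K) 0 (SU N))
      (lam : (j : ℕ) → Site (F.P K) j → MatA N)
      (_ : ∀ (j : ℕ) (y : Site (F.P K) j), ‖lam j y‖ ≤ ‖mlog (((((toMS uL j (castSite (lo j)))⁻¹ * toMS uL j y)⁻¹ : SU N)) : MatA N)‖)
      {X : BondIdx (cubeDomains (F.P K) a M ρ (K - n) hk) → MatA N}
      (_ : ∀ c : BondIdx (cubeDomains (F.P K) a M ρ (K - n) hk),
        X c = LatticeFieldCalculus.grad (((F.P K).L : ℝ) ^ (K - n) / ((F.P K).L : ℝ) ^ (c.1.1 : ℕ)) (lam c.1.1) c.1.2)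
      -- S3's gauge of `U` on the window, the (159)-splitting of `A − H_V X`
      {U : GaugeField (F.P K) 0 (SU N)} (u : GaugeTransf (F.P K) 0 (SU N)) {A A₁ A₂ A₃ : PBond (F.P K) 0 → MatA N} {t t₁ t₂ t₃ : ℝ}
      (_ : ∀ b ∈ (Sect2.regionOfSet (F.P K) (cover (F.P K) '' box (F.P K).L a M (K - n))).bonds,
        gaugeU (fun x => ιSU N (u x)) (fun b' => ιSU N (U b')) b = expI ((F.P K).eta (K - n)) (A b))
      (_ : ∀ b ∈ (Sect2.regionOfSet (F.P K) (cover (F.P K) '' box (F.P K).L a M (K - n))).bonds, ‖A b‖ < t)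
      (_ : ∀ q ∈ (Sect2.regionOfSet (F.P K) (cover (F.P K) '' box (F.P K).L a M (K - n))).dpairs,
        ‖grad ((F.P K).eta (K - n)) q.2.1 (fun y => A ⟨y, q.2.2⟩) q.1‖ < t)
      (_ : ∀ b, A b - HV X b = A₁ b + A₂ b - A₃ b)
      (_ : Letters10On (cover (F.P K) '' box (F.P K).L a M (K - n)) ((F.P K).eta (K - n)) t₁ A₁)
      (_ : Letters10On (cover (F.P K) '' box (F.P K).L a M (K - n)) ((F.P K).eta (K - n)) t₂ A₂)
      (_ : Letters10On (cover (F.P K) '' box (F.P K).L a M (K - n)) ((F.P K).eta (K - n)) t₃ A₃)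
      -- ★ the Landau side of the shear: the (152) equation and letter on a bond set containing the fine bonds of `□̃` (LOCATED-LANDAU-REGION), `0 ≤ t`, `η t ≤ 1`
      (_ : 0 ≤ t) (_ : (F.P K).eta (K - n) * t ≤ 1) {B : Set (PBond (F.P K) 0)}
      (_ : ∀ b ∈ B, gaugeU (fun x => ιSU N (u x)) (fun b' => ιSU N (U b')) b = expI ((F.P K).eta (K - n)) (A b)) (_ : ∀ b ∈ B, ‖A b‖ < t)
      (_ : ∀ b : PBond (F.P K) 0,
        b.src ∈ (castSite '' Set.Icc (tlo (F.P K).L (tLo a ρ) (K - n - 0)) (thi (F.P K).L (tHi a M ρ) (K - n - 0)) : Set (Site (F.P K) 0)) →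
        b.tgt ∈ (castSite '' Set.Icc (tlo (F.P K).L (tLo a ρ) (K - n - 0)) (thi (F.P K).L (tHi a M ρ) (K - n - 0)) : Set (Site (F.P K) 0)) → b ∈ B)
      -- ★ the data lane's letters on the `□̃`-tower for the averages of the representative `(U^{u})^{u♮}`: `a_i := 2α₀(Lⁱη)²` plaquette letters, radial gauge, top
      {α₀ : ℝ} (_ : 0 ≤ α₀) {vk : ℝ} (_ : 0 ≤ vk)
      (_ : ∀ i < K - n, AxialGauge (radialContourData (F.P K) i (SU N)) (Averaging.iter (avOfRecord F N K) i (gaugeAct uL (gaugeAct u U))))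
      (_ : ∀ i < K - n, (((((F.P K).d + 2) * (F.P K).L : ℕ) : ℝ) ^ 2 / 4) * (2 * α₀ * ((((F.P K).L : ℝ) ^ i * (F.P K).eta (K - n)) ^ 2)) < deltaSU (Fin N))
      (_ : ∀ i < K - n, ∀ c : PBond (F.P K) (i + 1),
        c.src ∈ (castSite '' Set.Icc (tlo (F.P K).L (tLo a ρ) (K - n - (i + 1))) (thi (F.P K).L (tHi a M ρ) (K - n - (i + 1))) : Set (Site (F.P K) (i + 1))) →
        c.tgt ∈ (castSite '' Set.Icc (tlo (F.P K).L (tLo a ρ) (K - n - (i + 1))) (thi (F.P K).L (tHi a M ρ) (K - n - (i + 1))) : Set (Site (F.P K) (i + 1))) → ∀ q : Plaq (F.P K) i,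
        (blockOf q.src = c.src.unshift c.dir ∨ blockOf q.src = c.src ∨ blockOf q.src = c.tgt) →
        dist1 (GaugeField.plaqHol (Averaging.iter (avOfRecord F N K) i (gaugeAct uL (gaugeAct u U))) q) < (2 * α₀ * ((((F.P K).L : ℝ) ^ i * (F.P K).eta (K - n)) ^ 2)))
      (_ : ∀ i < K - n, ∀ y : Site (F.P K) (i + 1),
        y ∈ (castSite '' Set.Icc (tlo (F.P K).L (tLo a ρ) (K - n - (i + 1))) (thi (F.P K).L (tHi a M ρ) (K - n - (i + 1))) : Set (Site (F.P K) (i + 1))) →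
        ∀ q : Plaq (F.P K) i, blockOf q.src = y → dist1 (GaugeField.plaqHol (Averaging.iter (avOfRecord F N K) i (gaugeAct uL (gaugeAct u U))) q) < (2 * α₀ * ((((F.P K).L : ℝ) ^ i * (F.P K).eta (K - n)) ^ 2)))
      (_ : ∀ c : PBond (F.P K) (K - n),
        c.src ∈ (castSite '' Set.Icc (tlo (F.P K).L (tLo a ρ) (K - n - (K - n))) (thi (F.P K).L (tHi a M ρ) (K - n - (K - n))) : Set (Site (F.P K) (K - n))) →
        c.tgt ∈ (castSite '' Set.Icc (tlo (F.P K).L (tLo a ρ) (K - n - (K - n))) (thi (F.P K).L (tHi a M ρ) (K - n - (K - n))) : Set (Site (F.P K) (K - n))) →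
        dist1 (Averaging.iter (avOfRecord F N K) (K - n) (gaugeAct uL (gaugeAct u U)) c) ≤ vk)
      -- ★ ONE smallness on the AFFINE shear letter `2d(M+4ρ+1)(4κα₀ + v_k + 2t)`
      (_ : 2 * (((F.P K).d : ℝ) * (((M + 4 * ρ + 1 : ℕ) : ℝ) * (4 * ((((F.P K).d * ((F.P K).L - 1) + 1 : ℕ) : ℝ) * ((((F.P K).d - 1 : ℕ) : ℝ) * (((F.P K).L - 1 : ℕ) : ℝ)) + 7 * (((((F.P K).d + 2) * (F.P K).L : ℕ) : ℝ) ^ 2 / 4) + ((((F.P K).d + 1) * ((F.P K).L - 1) : ℕ) : ℝ) * ((((F.P K).d * ((F.P K).L - 1) + 1 : ℕ) : ℝ) * ((((F.P K).d - 1 : ℕ) : ℝ) * (((F.P K).L - 1 : ℕ) : ℝ)))) * α₀ + vk + 2 * t))) ≤ 1 / 2)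
      {tD : ℝ} (_ : 2 * C * B₃ * (4 * (2 * (((F.P K).d : ℝ) * (((M + 4 * ρ + 1 : ℕ) : ℝ) * (4 * ((((F.P K).d * ((F.P K).L - 1) + 1 : ℕ) : ℝ) * ((((F.P K).d - 1 : ℕ) : ℝ) * (((F.P K).L - 1 : ℕ) : ℝ)) + 7 * (((((F.P K).d + 2) * (F.P K).L : ℕ) : ℝ) ^ 2 / 4) + ((((F.P K).d + 1) * ((F.P K).L - 1) : ℕ) : ℝ) * ((((F.P K).d * ((F.P K).L - 1) + 1 : ℕ) : ℝ) * ((((F.P K).d - 1 : ℕ) : ℝ) * (((F.P K).L - 1 : ℕ) : ℝ)))) * α₀ + vk + 2 * t))))) < tD),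
      LocalGaugeSplitOn (cover (F.P K) '' box (F.P K).L a M (K - n)) ((F.P K).eta (K - n)) t (t₁ + (t₂ + tD) + t₃) U := by
  obtain ⟨Mh₀, R₀, C, δ₀, δ₁, B₃, hC, hδ₀, hδ₁, hB₃, hmain⟩ := localGaugeSplitOn_of_gauge152_recordShearRadialTildeTower_cubeDomains_box F N
  refine ⟨Mh₀, R₀, C, δ₀, δ₁, B₃, hC, hδ₀, hδ₁, hB₃, ?_⟩
  intro n K hk1 hk' hk Mh R a' hMha hMh hR hsize a M ρ hM1 hρ ha hM hper hRρ hLρ hinj HV hHV lo hi hlo0 hhi0 hloj hhij uL lam hlam X hX U u A A₁ A₂ A₃ t t₁ t₂ t₃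
    he hA hdA h159 h₁ h₂ h₃ ht0 hηt B heB hAB hB α₀ hα0 vk hvk hax htL hplaq hplaqB htop hςaff tD htD
  -- §1: the explicit letter is below the affine one
  have hE := shearLetter_radial_le_affine (F.P K) hk1 M ρ (vk := vk) hα0 ht0
  have hCB : 0 ≤ 2 * C * B₃ := by positivity
  exact hmain n K hk1 hk' hk hMha hMh hR hsize hM1 hρ ha hM hper hRρ hLρ hinj hHV hlo0 hhi0 hloj hhij uL lam hlam hX u he hA hdA h159 h₁ h₂ h₃
    ht0 hηt heB hAB hB (fun i => 2 * α₀ * ((((F.P K).L : ℝ) ^ i * (F.P K).eta (K - n)) ^ 2)) (fun i _ => by positivity) hvk hax htL hplaq hplaqB htop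
    (hE.trans hςaff) (lt_of_le_of_lt (mul_le_mul_of_nonneg_left (mul_le_mul_of_nonneg_left hE (by norm_num)) hCB) htD)

end Door

end Summit.QuantumFields.YangMills.BalabanUVNodes.N07ShearLetterAffine

end
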